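import Summits.BirchSwinnertonDyer.BirchSwinnertonDyer.Theorems.QuadraticBranchSignedControlPlusEtaNonsurjPlusCoeffCongruenceQuotient
import HarnessLib

/-!
# Route `QuadraticBranchSignedControl` (rung K8, cell `bsd-potss`), residual crux `PlusEtaMainConjectureNonsurj`
# (stmt-BirchSwinnertonDyer-19606): THE QUOTIENT READING — RANGE AND VALUATIONS: at level `2m` the exact quotient `θ_{2m}(η)/ω⁻_{2m}` is
# `L_p⁺(V,η)` (up to `±v·ϖ`) to precision `p^{m−i}` in ALL degrees `≤ p^{2i+1}(p−1)` (`i ≤ m`), so level `2m` reads every `λ⁺ ≤ p^{2m−1}(p−1)`; and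
# below the precision the VALUATIONS of the coefficients of `L_p⁺` are read exactly (seat `bsd-potss-k8eta-c2` g26; sequel of `…PlusCoeffCongruenceQuotient.lean`)

WHY. The prequel proves `ℓ_m := θ_{2m}(η)/ω⁻_{2m} = (−1)^{m+1}M⁺ + X·ω⁺_{2m}·q` in `Λ` and uses `p^m ∣ (ω⁺_{2m})_j` for `j < p(p−1)` (the degree of the
FIRST factor `Φ_{p²}(1+X)` of `ω⁺_{2m} = ∏_{i<m}Φ_{p^{2i+2}}(1+X)`): precision `p^m` in degrees `≤ p(p−1)`. The sharp range statement trades precision for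
degrees: the factors `Φ_{p^{2k+2}}(1+X)` with `k ≥ i` are Eisenstein of degree `p^{2k+1}(p−1) ≥ p^{2i+1}(p−1)`, so `p^{m−i} ∣ (ω⁺_{2m})_j` for every
`j < p^{2i+1}(p−1)` (§17), whence `coeff_kℓ_m ≡ (−1)^{m+1}coeff_kM⁺ (mod p^{m−i})` for `k ≤ p^{2i+1}(p−1)` and, for every plus branch function `L`,
`‖coeff_kL − v(−1)^{m+1}ϖ·coeff_kℓ_m‖ ≤ p^{−(m−i)}`; with `i < m` the per-coefficient unit reading holds in ALL degrees `≤ p^{2i+1}(p−1)` — at `i = m − 1`,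
level `2m` reads `μ⁺ = 0` and every `λ⁺ ≤ p^{2m−1}(p−1)` (§18; level 2: `p(p−1)`, level 4: `p³(p−1)`, …). §19 reads VALUATIONS: whenever
`‖ϖ·coeff_kℓ_m‖ > p^{−m}` it IS `‖coeff_kL‖` (so at level `2m` the slopes of the Newton polygon of `L_p⁺` below height `m` are read off the quotient), and
`‖ϖ·coeff_kℓ_m‖ ≤ p^{−m} ⟺ ‖coeff_kL‖ ≤ p^{−m}`.

WHAT. §17 `dvd_coeff_mul_of_forall_dvd_coeff` (folklore), `dvd_coeff_cyclotomic_prime_pow_succ_comp_X_add_one` (`p ∣ (Φ_{p^{n+1}}(1+X))_j`, `j < p^n(p−1)`),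
`pow_dvd_coeff_cyclotomicOmegaPlus_two_mul_of_lt` (`p^{m−i} ∣ (ω⁺_{2m})_j`, `j < p^{2i+1}(p−1)`), `pow_dvd_coeff_X_mul_cyclotomicOmegaPlus_mul_of_le`,
`exists_coeff_quotient_plus_eq_of_le`; §18 `exists_units_forall_norm_coeff_sub_quotient_le_of_le` (master estimate, precision `p^{m−i}`),
`isUnit_coeff_plus_iff_norm_quotient_eq_one_of_lt` / `not_isUnit_coeff_plus_iff_norm_quotient_le_of_lt` (per-coefficient reading in degrees
`≤ p^{2i+1}(p−1)`, `i < m`), `quotient_padicNorm_iff_firstUnitCoeff_of_lt` (the λ⁺-pattern equivalence, every `λ ≤ p^{2i+1}(p−1)`); §19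
`norm_coeff_plus_eq_norm_quotient_of_lt`, `norm_coeff_plus_le_iff_norm_quotient_le` (valuation reading at precision `p^m`, degrees `≤ p(p−1)`).

HONEST FRAMING (cell `bsd-potss`; FULL-BSD rank ≤ 1 programme, HUMAN RULING D-0036/D-0074): TOOL THEOREMS ONLY — no definition, no named fact,
no `sorry`, axioms standard; no consumer today beyond the prequel's (every census `λ⁺ ≤ 9 ≤ p(p−1)`); nothing about (A), (C1⁺_η), C-cc-1 or `BSD(W,p)`
of any pair is claimed; `stub_analyticEtaMu_cm` is NOT proved; crux and route OPEN; nothing booked. `--supports stmt-BirchSwinnertonDyer-19606`.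

References: [Pollack2003] Prop. 6.18 (proof), §6.5; [Kobayashi2003] Thm. 3.2, (3.4) (p. 7); [Washington1997] §7.1. Tree: `…PlusCoeffCongruenceQuotient.lean`
(`exists_quotient_map_eq_and_coe_eq`, `exists_units_forall_norm_coeff_sub_quotient_le`), `…MinusCoeffCongruenceHigher.lean` (`pow_dvd_coeff_prod_range`),
Mathlib `cyclotomic_prime_pow_comp_X_add_one_isEisensteinAt`.
-/

set_option autoImplicit false
set_option linter.dupNamespace false
noncomputable section

open scoped Classical MatrixGroups ModularForm

open CongruenceSubgroup Polynomial Literature.NumberTheory.EllipticCurves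
  Literature.NumberTheory.EllipticCurves.ModularForms
  Literature.NumberTheory.EllipticCurves.GreenbergVatsal2000
open Summit.BirchSwinnertonDyer.Rank1Residual Summit.BirchSwinnertonDyer.Rank1Residual.Additive
open Summit.BirchSwinnertonDyer.BirchSwinnertonDyer.Theorems.EtaMinusCoeffCongruence

namespace Summit.BirchSwinnertonDyer.BirchSwinnertonDyer.Theorems.EtaPlusCoeffCongruence

variable {p : ℕ} [hp : Fact p.Prime] {N : ℕ} [NeZero N] {f : CuspForm (Gamma0 N) 2}

/-! ## §17 `p^{m−i} ∣ (ω⁺_{2m})_j` for `j < p^{2i+1}(p−1)` and the coefficient congruence in that range -/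

omit [NeZero N] hp in
/-- If `c` divides the coefficients of `B` below `D` then it divides those of `A·B` below `D` (`(A·B)_j = Σ_{a+b=j}A_aB_b`, `b ≤ j`). [folklore] -/
theorem dvd_coeff_mul_of_forall_dvd_coeff {c : ℤ} {A B : ℤ[X]} {D : ℕ} (hB : ∀ j < D, c ∣ B.coeff j) :
    ∀ j < D, c ∣ (A * B).coeff j := by
  intro j hj
  rw [coeff_mul]
  refine Finset.dvd_sum fun x hx ↦ ?_
  have hab : x.1 + x.2 = j := Finset.HasAntidiagonal.mem_antidiagonal.mp hx
  exact Dvd.dvd.mul_left (hB x.2 (by omega)) _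

omit [NeZero N] in
/-- The coefficients of `Φ_{p^{n+1}}(1+X)` below its degree `p^n(p−1)` lie in `(p)` (Eisenstein at `p`). [cite: Washington1997, §7.1] -/
theorem dvd_coeff_cyclotomic_prime_pow_succ_comp_X_add_one (n : ℕ) :
    ∀ j < p ^ n * (p - 1), (p : ℤ) ∣ ((cyclotomic (p ^ (n + 1)) ℤ).comp (X + 1)).coeff j := by
  intro j hj
  have hP := hp.out
  have hE := cyclotomic_prime_pow_comp_X_add_one_isEisensteinAt p n
  have hdeg : ((cyclotomic (p ^ (n + 1)) ℤ).comp (X + 1)).natDegree = p ^ n * (p - 1) := by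
    rw [natDegree_comp, natDegree_cyclotomic, Nat.totient_prime_pow hP (by omega),
      show (X + 1 : ℤ[X]) = X + C 1 by rw [C_1], natDegree_X_add_C, mul_one, show n + 1 - 1 = n from rfl]
  have hlt : j < ((cyclotomic (p ^ (n + 1)) ℤ).comp (X + 1)).natDegree := by rw [hdeg]; exact hj
  exact Ideal.mem_span_singleton.mp (hE.mem hlt)

omit [NeZero N] in
/-- **`p^{m−i} ∣ (ω⁺_{2m})_j` for every `j < p^{2i+1}(p−1)`** (`i ≤ m`): in `ω⁺_{2m} = ∏_{k<m}Φ_{p^{2k+2}}(1+X)` the `m − i` factors with `k ≥ i` are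
Eisenstein of degree `p^{2k+1}(p−1) ≥ p^{2i+1}(p−1)`. At `i = 0` this is g24's `pow_dvd_coeff_cyclotomicOmegaPlus_two_mul_add_one` (`p^m`, `j < p(p−1)`).
[cite: Pollack2003, §6.5 (display before Prop. 6.18)] [cite: Washington1997, §7.1] -/
theorem pow_dvd_coeff_cyclotomicOmegaPlus_two_mul_of_lt (m i : ℕ) (hi : i ≤ m) :
    ∀ j < p ^ (2 * i + 1) * (p - 1), (p : ℤ) ^ (m - i) ∣ (cyclotomicOmegaPlus p (2 * m)).coeff j := by
  have hP := hp.out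
  set F : ℕ → ℤ[X] := fun k ↦ (cyclotomic (p ^ (2 * k + 2)) ℤ).comp (X + 1) with hF
  have hsplit : cyclotomicOmegaPlus p (2 * m) =
      (∏ k ∈ Finset.range i, F k) * ∏ t ∈ Finset.range (m - i), F (i + t) := by
    rw [cyclotomicOmegaPlus_two_mul_eq_prod, ← Finset.prod_range_mul_prod_Ico F hi, Finset.prod_Ico_eq_prod_range]
  rw [hsplit]
  refine dvd_coeff_mul_of_forall_dvd_coeff ?_
  refine pow_dvd_coeff_prod_range (fun t ↦ F (i + t)) (fun t j hj ↦ ?_) (m - i)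
  have h := dvd_coeff_cyclotomic_prime_pow_succ_comp_X_add_one (p := p) (2 * (i + t) + 1) j ?_
  · rw [hF]
    dsimp only
    rw [show 2 * (i + t) + 2 = 2 * (i + t) + 1 + 1 by ring]
    exact h
  · calc j < p ^ (2 * i + 1) * (p - 1) := hj
      _ ≤ p ^ (2 * (i + t) + 1) * (p - 1) :=
          Nat.mul_le_mul_right _ (Nat.pow_le_pow_right hP.pos (by omega))

omit [NeZero N] in
/-- **`p^{m−i} ∣ (X·ω⁺_{2m}·q)_k` for every `q ∈ Λ` and every `k ≤ p^{2i+1}(p−1)`** (`i ≤ m`). [cite: Pollack2003, §6.5 (display before Prop. 6.18)] -/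
theorem pow_dvd_coeff_X_mul_cyclotomicOmegaPlus_mul_of_le (m i : ℕ) (hi : i ≤ m) (q : IwasawaAlgebra p) {k : ℕ}
    (hk : k ≤ p ^ (2 * i + 1) * (p - 1)) :
    (p : ℤ_[p]) ^ (m - i) ∣ PowerSeries.coeff k
      ((((X * cyclotomicOmegaPlus p (2 * m)).map (Int.castRingHom ℤ_[p]) : ℤ_[p][X]) : PowerSeries ℤ_[p]) * q) := by
  rw [PowerSeries.coeff_mul]
  refine Finset.dvd_sum fun x hx ↦ ?_
  have hsum : x.1 + x.2 = k := Finset.HasAntidiagonal.mem_antidiagonal.mp hx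
  refine Dvd.dvd.mul_right ?_ _
  rw [Polynomial.coeff_coe, Polynomial.coeff_map]
  rcases Nat.eq_zero_or_pos x.1 with h0 | hpos
  · rw [h0, Polynomial.coeff_X_mul_zero, map_zero]
    exact dvd_zero _
  · obtain ⟨j, hj⟩ : ∃ j, x.1 = j + 1 := ⟨x.1 - 1, by omega⟩
    rw [hj, Polynomial.coeff_X_mul]
    have hdvd := pow_dvd_coeff_cyclotomicOmegaPlus_two_mul_of_lt (p := p) m i hi j (by omega)
    have h := map_dvd (Int.castRingHom ℤ_[p]) hdvd
    rwa [map_pow, map_natCast] at h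

/-- **THE COEFFICIENT CONGRUENCE IN THE WIDE RANGE: `coeff_kℓ_m ≡ (−1)^{m+1}coeff_kM⁺ (mod p^{m−i})` for `k ≤ p^{2i+1}(p−1)`** (`i ≤ m`;
`ℓ_m = θ_{2m}(η)/ω⁻_{2m}` the exact quotient, `M` the even-level limit at level `2m`). [cite: Pollack2003, Prop. 6.18 (proof)] [cite: Kobayashi2003, Thm. 3.2 and (3.4) (p. 7)] -/
theorem exists_coeff_quotient_plus_eq_of_le (hp2 : p ≠ 2) (hf0 : IsNewform0 f) (hQ : coeffField f = ⊥)
    (hpN : ¬ p ∣ N) (hap : cuspCoeff f p = ((0 : ℤ) : ℂ)) (m i : ℕ) (hi : i ≤ m) {M : IwasawaAlgebra p}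
    (hM : IsCongrModOmega p (2 * m) (quadraticBranchMazurTateElement p f (2 * m))
      ((-1) ^ (m + 1) * cyclotomicOmegaMinus p (2 * m)) M) {k : ℕ} (hk : k ≤ p ^ (2 * i + 1) * (p - 1)) :
    ∃ r : ℤ_[p], (((quadraticBranchMazurTateElement p f (2 * m) /ₘ
        (cyclotomicOmegaMinus p (2 * m)).map (Int.castRingHom ℚ)).coeff k : ℚ) : ℚ_[p]) =
      (-1) ^ (m + 1) * ((PowerSeries.coeff k M : ℤ_[p]) : ℚ_[p]) + (p : ℚ_[p]) ^ (m - i) * (r : ℚ_[p]) := by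
  obtain ⟨Q, q, hQmap, hQeq⟩ := exists_quotient_map_eq_and_coe_eq hp2 hf0 hQ hpN hap m hM
  obtain ⟨r, hr⟩ := pow_dvd_coeff_X_mul_cyclotomicOmegaPlus_mul_of_le m i hi q hk
  refine ⟨r, ?_⟩
  have hε : ((-1 : PowerSeries ℤ_[p]) ^ (m + 1)) = PowerSeries.C ((-1 : ℤ_[p]) ^ (m + 1)) := by
    rw [map_pow, map_neg, map_one]
  have hk' := congrArg (PowerSeries.coeff k) hQeq
  rw [Polynomial.coeff_coe, map_add, hε, PowerSeries.coeff_C_mul, hr] at hk'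
  have hc := congrArg (fun P : ℚ_[p][X] ↦ P.coeff k) hQmap
  simp only [Polynomial.coeff_map, eq_ratCast] at hc
  rw [← hc, PadicInt.algebraMap_apply, hk']
  push_cast
  ring

/-! ## §18 The reading in the wide range: precision `p^{m−i}`, degrees `≤ p^{2i+1}(p−1)` -/

/-- **MASTER ESTIMATE IN THE WIDE RANGE.** For every plus branch function `L` (`‖ϖ‖_p ≤ 1`) there is `v ∈ ℤ_pˣ` with
`‖coeff_kL − v(−1)^{m+1}ϖ·coeff_kℓ_m‖_p ≤ p^{−(m−i)}` for all `m`, `i ≤ m`, `k ≤ p^{2i+1}(p−1)`. [cite: Pollack2003, Prop. 6.18] [cite: Kobayashi2003, Thm. 3.2 and (3.4) (p. 7)] -/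
theorem exists_units_forall_norm_coeff_sub_quotient_le_of_le (hp2 : p ≠ 2) (hf0 : IsNewform0 f) (hQ : coeffField f = ⊥)
    (hpN : ¬ p ∣ N) (hap : cuspCoeff f p = ((0 : ℤ) : ℂ)) {ϖ : ℚ} (hϖ : ‖(ϖ : ℚ_[p])‖ ≤ 1)
    {L : IwasawaAlgebra p} (hL : IsQuadraticBranchPlusLFunction f p ϖ L) :
    ∃ v : ℤ_[p]ˣ, ∀ (m i k : ℕ), i ≤ m → k ≤ p ^ (2 * i + 1) * (p - 1) →
      ‖((PowerSeries.coeff k L : ℤ_[p]) : ℚ_[p]) - ((v : ℤ_[p]) : ℚ_[p]) * (-1) ^ (m + 1) *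
          ((ϖ : ℚ_[p]) * (((quadraticBranchMazurTateElement p f (2 * m) /ₘ
            (cyclotomicOmegaMinus p (2 * m)).map (Int.castRingHom ℚ)).coeff k : ℚ) : ℚ_[p]))‖ ≤ ((p : ℝ)⁻¹) ^ (m - i) := by
  have hP : p.Prime := hp.out
  have hp0 : (0 : ℝ) < p := by exact_mod_cast hP.pos
  obtain ⟨M, hM⟩ := exists_isCongrModOmega_quadraticBranch_even hp2 hf0 hQ hpN hap
  obtain ⟨v, hv⟩ := exists_units_forall_coeff_eq_plus hp2 hϖ hL hM
  refine ⟨v, fun m i k hi hk ↦ ?_⟩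
  obtain ⟨r, hr⟩ := exists_coeff_quotient_plus_eq_of_le hp2 hf0 hQ hpN hap m i hi (hM m) hk
  have hσ : ((-1 : ℚ_[p]) ^ (m + 1)) * (-1) ^ (m + 1) = 1 := by
    rw [← mul_pow, neg_one_mul, neg_neg, one_pow]
  have hdiff : ((PowerSeries.coeff k L : ℤ_[p]) : ℚ_[p]) - ((v : ℤ_[p]) : ℚ_[p]) * (-1) ^ (m + 1) *
      ((ϖ : ℚ_[p]) * (((quadraticBranchMazurTateElement p f (2 * m) /ₘ
        (cyclotomicOmegaMinus p (2 * m)).map (Int.castRingHom ℚ)).coeff k : ℚ) : ℚ_[p])) =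
      -(((v : ℤ_[p]) : ℚ_[p]) * (-1) ^ (m + 1) * ((p : ℚ_[p]) ^ (m - i) * ((ϖ : ℚ_[p]) * (r : ℚ_[p])))) := by
    rw [hv k, hr]
    linear_combination (-((v : ℤ_[p]) : ℚ_[p]) * ((ϖ : ℚ_[p]) * ((PowerSeries.coeff k M : ℤ_[p]) : ℚ_[p]))) * hσ
  rw [hdiff, norm_neg, norm_mul, norm_mul, norm_mul, norm_pow, norm_neg, norm_one, one_pow, mul_one,
    PadicInt.padic_norm_e_of_padicInt, PadicInt.norm_units, one_mul, norm_pow, Padic.norm_p, norm_mul,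
    PadicInt.padic_norm_e_of_padicInt]
  calc ((p : ℝ)⁻¹) ^ (m - i) * (‖(ϖ : ℚ_[p])‖ * ‖r‖) ≤ ((p : ℝ)⁻¹) ^ (m - i) * (1 * 1) := by
        gcongr
        exact PadicInt.norm_le_one r
    _ = ((p : ℝ)⁻¹) ^ (m - i) := by rw [mul_one, mul_one]

/-- **THE PER-COEFFICIENT UNIT READING IN THE WIDE RANGE** (`i < m`, `k ≤ p^{2i+1}(p−1)`; at `i = m − 1`: all `k ≤ p^{2m−1}(p−1)` at level `2m`):
`coeff_kL ∈ ℤ_pˣ ⟺ ‖ϖ·coeff_kℓ_m‖_p = 1`. [cite: Pollack2003, Prop. 6.18] [cite: Washington1997, §7.1] -/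
theorem isUnit_coeff_plus_iff_norm_quotient_eq_one_of_lt (hp2 : p ≠ 2) (hf0 : IsNewform0 f) (hQ : coeffField f = ⊥)
    (hpN : ¬ p ∣ N) (hap : cuspCoeff f p = ((0 : ℤ) : ℂ)) {ϖ : ℚ} (hϖ : ‖(ϖ : ℚ_[p])‖ ≤ 1)
    {L : IwasawaAlgebra p} (hL : IsQuadraticBranchPlusLFunction f p ϖ L) (m i : ℕ) (him : i < m) {k : ℕ}
    (hk : k ≤ p ^ (2 * i + 1) * (p - 1)) :
    IsUnit (PowerSeries.coeff k L) ↔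
      ‖(ϖ : ℚ_[p]) * (((quadraticBranchMazurTateElement p f (2 * m) /ₘ
        (cyclotomicOmegaMinus p (2 * m)).map (Int.castRingHom ℚ)).coeff k : ℚ) : ℚ_[p])‖ = 1 := by
  have hP : p.Prime := hp.out
  have hp1 : (1 : ℝ) < p := by exact_mod_cast hP.one_lt
  have hp0 : (0 : ℝ) < p := by positivity
  obtain ⟨v, hv⟩ := exists_units_forall_norm_coeff_sub_quotient_le_of_le hp2 hf0 hQ hpN hap hϖ hL
  have hest := hv m i k him.le hk
  set a : ℚ_[p] := ((PowerSeries.coeff k L : ℤ_[p]) : ℚ_[p]) with ha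
  set c : ℚ_[p] := (ϖ : ℚ_[p]) * (((quadraticBranchMazurTateElement p f (2 * m) /ₘ
    (cyclotomicOmegaMinus p (2 * m)).map (Int.castRingHom ℚ)).coeff k : ℚ) : ℚ_[p]) with hc
  set b : ℚ_[p] := ((v : ℤ_[p]) : ℚ_[p]) * (-1) ^ (m + 1) * c with hb
  have hnb : ‖b‖ = ‖c‖ := by
    rw [hb, norm_mul, norm_mul, PadicInt.padic_norm_e_of_padicInt, PadicInt.norm_units, one_mul, norm_pow, norm_neg,
      norm_one, one_pow, one_mul]
  have hlt1 : ‖a - b‖ < 1 :=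
    hest.trans_lt (pow_lt_one₀ (inv_nonneg.mpr hp0.le) (inv_lt_one_of_one_lt₀ hp1) (by omega))
  have hna : ‖a‖ = ‖PowerSeries.coeff k L‖ := by rw [ha, PadicInt.padic_norm_e_of_padicInt]
  rw [PadicInt.isUnit_iff, ← hna, ← hnb]
  constructor
  · intro h1
    have hne : ‖a‖ ≠ ‖-(a - b)‖ := by rw [norm_neg, h1]; exact (ne_of_lt hlt1).symm
    have e : b = a + -(a - b) := by ring
    rw [e, Padic.add_eq_max_of_ne hne, norm_neg, max_eq_left (h1 ▸ hlt1.le), h1]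
  · intro h1
    have hne : ‖a - b‖ ≠ ‖b‖ := by rw [h1]; exact ne_of_lt hlt1
    have e : a = (a - b) + b := by ring
    rw [e, Padic.add_eq_max_of_ne hne, h1, max_eq_right hlt1.le]

/-- The complementary reading in the wide range: `coeff_kL ∉ ℤ_pˣ ⟺ ‖ϖ·coeff_kℓ_m‖_p ≤ p⁻¹` (`i < m`, `k ≤ p^{2i+1}(p−1)`).
[cite: Pollack2003, Prop. 6.18] [cite: Washington1997, §7.1] -/
theorem not_isUnit_coeff_plus_iff_norm_quotient_le_of_lt (hp2 : p ≠ 2) (hf0 : IsNewform0 f) (hQ : coeffField f = ⊥)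
    (hpN : ¬ p ∣ N) (hap : cuspCoeff f p = ((0 : ℤ) : ℂ)) {ϖ : ℚ} (hϖ : ‖(ϖ : ℚ_[p])‖ ≤ 1)
    {L : IwasawaAlgebra p} (hL : IsQuadraticBranchPlusLFunction f p ϖ L) (m i : ℕ) (him : i < m) {k : ℕ}
    (hk : k ≤ p ^ (2 * i + 1) * (p - 1)) :
    ¬ IsUnit (PowerSeries.coeff k L) ↔
      ‖(ϖ : ℚ_[p]) * (((quadraticBranchMazurTateElement p f (2 * m) /ₘ
        (cyclotomicOmegaMinus p (2 * m)).map (Int.castRingHom ℚ)).coeff k : ℚ) : ℚ_[p])‖ ≤ (p : ℝ)⁻¹ := by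
  have hP : p.Prime := hp.out
  have hp1 : (1 : ℝ) < p := by exact_mod_cast hP.one_lt
  rw [isUnit_coeff_plus_iff_norm_quotient_eq_one_of_lt hp2 hf0 hQ hpN hap hϖ hL m i him hk]
  obtain ⟨M, hM⟩ := exists_isCongrModOmega_quadraticBranch_even hp2 hf0 hQ hpN hap
  obtain ⟨Q, q, hQmap, -⟩ := exists_quotient_map_eq_and_coe_eq hp2 hf0 hQ hpN hap m (hM m)
  have hc := congrArg (fun P : ℚ_[p][X] ↦ P.coeff k) hQmap
  simp only [Polynomial.coeff_map, eq_ratCast] at hc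
  set c : ℚ_[p] := (ϖ : ℚ_[p]) * (((quadraticBranchMazurTateElement p f (2 * m) /ₘ
    (cyclotomicOmegaMinus p (2 * m)).map (Int.castRingHom ℚ)).coeff k : ℚ) : ℚ_[p]) with hcdef
  have hle : ‖c‖ ≤ 1 := by
    rw [hcdef, ← hc, PadicInt.algebraMap_apply, norm_mul, PadicInt.padic_norm_e_of_padicInt]
    calc ‖(ϖ : ℚ_[p])‖ * ‖Q.coeff k‖ ≤ 1 * 1 := by gcongr; exact PadicInt.norm_le_one _
      _ = 1 := mul_one 1
  constructor
  · intro hne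
    have hlt : ‖c‖ < 1 := lt_of_le_of_ne hle hne
    have h := (Padic.norm_le_pow_iff_norm_lt_pow_add_one c (-1)).mpr
      (by rwa [show (-1 : ℤ) + 1 = 0 by norm_num, zpow_zero])
    rwa [zpow_neg, zpow_one] at h
  · intro h h1
    rw [h1] at h
    exact absurd h (not_le.mpr (inv_lt_one_of_one_lt₀ hp1))

/-- **THE EQUIVALENCE IN THE WIDE RANGE.** For a plus branch function `L` (`‖ϖ‖_p ≤ 1`), `i < m`, `λ ≤ p^{2i+1}(p−1)`: the quotient pattern at level `2m`
(«`‖ϖ·coeff_jℓ_m‖ ≤ p⁻¹` for `j < λ`, `‖ϖ·coeff_λℓ_m‖ = 1`») holds iff `coeff_jL ∉ ℤ_pˣ` (`j < λ`) and `coeff_λL ∈ ℤ_pˣ` — iff `μ(L) = 0 ∧ λ(L) = λ`. At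
`i = m − 1`: level `2m` reads every `λ ≤ p^{2m−1}(p−1)`. [cite: Pollack2003, Prop. 6.18] [cite: Washington1997, §7.1] -/
theorem quotient_padicNorm_iff_firstUnitCoeff_of_lt (hp2 : p ≠ 2) (hf0 : IsNewform0 f) (hQ : coeffField f = ⊥)
    (hpN : ¬ p ∣ N) (hap : cuspCoeff f p = ((0 : ℤ) : ℂ)) {ϖ : ℚ} (hϖ : ‖(ϖ : ℚ_[p])‖ ≤ 1)
    {L : IwasawaAlgebra p} (hL : IsQuadraticBranchPlusLFunction f p ϖ L) (m i : ℕ) (him : i < m) {lam : ℕ}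
    (hlam : lam ≤ p ^ (2 * i + 1) * (p - 1)) :
    ((∀ j < lam, ‖(ϖ : ℚ_[p]) * (((quadraticBranchMazurTateElement p f (2 * m) /ₘ
        (cyclotomicOmegaMinus p (2 * m)).map (Int.castRingHom ℚ)).coeff j : ℚ) : ℚ_[p])‖ ≤ (p : ℝ)⁻¹) ∧
      ‖(ϖ : ℚ_[p]) * (((quadraticBranchMazurTateElement p f (2 * m) /ₘ
        (cyclotomicOmegaMinus p (2 * m)).map (Int.castRingHom ℚ)).coeff lam : ℚ) : ℚ_[p])‖ = 1) ↔
    ((∀ j < lam, ¬ IsUnit (PowerSeries.coeff j L)) ∧ IsUnit (PowerSeries.coeff lam L)) :=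
  ⟨fun h ↦ ⟨fun j hj ↦ (not_isUnit_coeff_plus_iff_norm_quotient_le_of_lt hp2 hf0 hQ hpN hap hϖ hL m i him (by omega)).mpr (h.1 j hj),
      (isUnit_coeff_plus_iff_norm_quotient_eq_one_of_lt hp2 hf0 hQ hpN hap hϖ hL m i him hlam).mpr h.2⟩,
    fun h ↦ ⟨fun j hj ↦ (not_isUnit_coeff_plus_iff_norm_quotient_le_of_lt hp2 hf0 hQ hpN hap hϖ hL m i him (by omega)).mp (h.1 j hj),
      (isUnit_coeff_plus_iff_norm_quotient_eq_one_of_lt hp2 hf0 hQ hpN hap hϖ hL m i him hlam).mp h.2⟩⟩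

/-! ## §19 The valuation reading (precision `p^m`, degrees `≤ p(p−1)`) -/

/-- **VALUATIONS ABOVE THE PRECISION ARE READ EXACTLY.** For a plus branch function `L` (`‖ϖ‖_p ≤ 1`) and `k ≤ p(p−1)`: if `‖ϖ·coeff_kℓ_m‖_p > p^{−m}`
then `‖coeff_kL‖_p = ‖ϖ·coeff_kℓ_m‖_p` (ultrametric: the two differ, up to the unit `±v`, by a term of norm `≤ p^{−m}`). At level `2m` the quotient thus
gives every coefficient valuation of `L_p⁺(V,η)` that is `< m`, exactly. [cite: Pollack2003, Prop. 6.18] [cite: Washington1997, §7.1] -/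
theorem norm_coeff_plus_eq_norm_quotient_of_lt (hp2 : p ≠ 2) (hf0 : IsNewform0 f) (hQ : coeffField f = ⊥)
    (hpN : ¬ p ∣ N) (hap : cuspCoeff f p = ((0 : ℤ) : ℂ)) {ϖ : ℚ} (hϖ : ‖(ϖ : ℚ_[p])‖ ≤ 1)
    {L : IwasawaAlgebra p} (hL : IsQuadraticBranchPlusLFunction f p ϖ L) (m : ℕ) {k : ℕ} (hk : k ≤ p * (p - 1))
    (hlt : ((p : ℝ)⁻¹) ^ m < ‖(ϖ : ℚ_[p]) * (((quadraticBranchMazurTateElement p f (2 * m) /ₘ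
        (cyclotomicOmegaMinus p (2 * m)).map (Int.castRingHom ℚ)).coeff k : ℚ) : ℚ_[p])‖) :
    ‖PowerSeries.coeff k L‖ = ‖(ϖ : ℚ_[p]) * (((quadraticBranchMazurTateElement p f (2 * m) /ₘ
        (cyclotomicOmegaMinus p (2 * m)).map (Int.castRingHom ℚ)).coeff k : ℚ) : ℚ_[p])‖ := by
  obtain ⟨v, hv⟩ := exists_units_forall_norm_coeff_sub_quotient_le hp2 hf0 hQ hpN hap hϖ hL
  have hest := hv m k hk
  set a : ℚ_[p] := ((PowerSeries.coeff k L : ℤ_[p]) : ℚ_[p]) with ha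
  set c : ℚ_[p] := (ϖ : ℚ_[p]) * (((quadraticBranchMazurTateElement p f (2 * m) /ₘ
    (cyclotomicOmegaMinus p (2 * m)).map (Int.castRingHom ℚ)).coeff k : ℚ) : ℚ_[p]) with hc
  set b : ℚ_[p] := ((v : ℤ_[p]) : ℚ_[p]) * (-1) ^ (m + 1) * c with hb
  have hnb : ‖b‖ = ‖c‖ := by
    rw [hb, norm_mul, norm_mul, PadicInt.padic_norm_e_of_padicInt, PadicInt.norm_units, one_mul, norm_pow, norm_neg,
      norm_one, one_pow, one_mul]
  have hlt' : ‖a - b‖ < ‖b‖ := by rw [hnb]; exact hest.trans_lt hlt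
  have e : a = (a - b) + b := by ring
  rw [← PadicInt.padic_norm_e_of_padicInt, ← ha, ← hnb, e, Padic.add_eq_max_of_ne hlt'.ne, max_eq_right hlt'.le]

/-- **BELOW THE PRECISION.** For a plus branch function `L` (`‖ϖ‖_p ≤ 1`) and `k ≤ p(p−1)`: `‖coeff_kL‖_p ≤ p^{−m} ⟺ ‖ϖ·coeff_kℓ_m‖_p ≤ p^{−m}`.
[cite: Pollack2003, Prop. 6.18] [cite: Washington1997, §7.1] -/
theorem norm_coeff_plus_le_iff_norm_quotient_le (hp2 : p ≠ 2) (hf0 : IsNewform0 f) (hQ : coeffField f = ⊥)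
    (hpN : ¬ p ∣ N) (hap : cuspCoeff f p = ((0 : ℤ) : ℂ)) {ϖ : ℚ} (hϖ : ‖(ϖ : ℚ_[p])‖ ≤ 1)
    {L : IwasawaAlgebra p} (hL : IsQuadraticBranchPlusLFunction f p ϖ L) (m : ℕ) {k : ℕ} (hk : k ≤ p * (p - 1)) :
    ‖PowerSeries.coeff k L‖ ≤ ((p : ℝ)⁻¹) ^ m ↔
      ‖(ϖ : ℚ_[p]) * (((quadraticBranchMazurTateElement p f (2 * m) /ₘ
        (cyclotomicOmegaMinus p (2 * m)).map (Int.castRingHom ℚ)).coeff k : ℚ) : ℚ_[p])‖ ≤ ((p : ℝ)⁻¹) ^ m := by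
  obtain ⟨v, hv⟩ := exists_units_forall_norm_coeff_sub_quotient_le hp2 hf0 hQ hpN hap hϖ hL
  have hest := hv m k hk
  set a : ℚ_[p] := ((PowerSeries.coeff k L : ℤ_[p]) : ℚ_[p]) with ha
  set c : ℚ_[p] := (ϖ : ℚ_[p]) * (((quadraticBranchMazurTateElement p f (2 * m) /ₘ
    (cyclotomicOmegaMinus p (2 * m)).map (Int.castRingHom ℚ)).coeff k : ℚ) : ℚ_[p]) with hc
  set b : ℚ_[p] := ((v : ℤ_[p]) : ℚ_[p]) * (-1) ^ (m + 1) * c with hb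
  have hnb : ‖b‖ = ‖c‖ := by
    rw [hb, norm_mul, norm_mul, PadicInt.padic_norm_e_of_padicInt, PadicInt.norm_units, one_mul, norm_pow, norm_neg,
      norm_one, one_pow, one_mul]
  have hna : ‖a‖ = ‖PowerSeries.coeff k L‖ := by rw [ha, PadicInt.padic_norm_e_of_padicInt]
  rw [← hna, ← hnb]
  constructor
  · intro h
    have e : b = a + -(a - b) := by ring
    rw [e]
    refine (IsUltrametricDist.norm_add_le_max _ _).trans (max_le h ?_)
    rw [norm_neg]; exact hest
  · intro h
    have e : a = (a - b) + b := by ring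
    rw [e]
    exact (IsUltrametricDist.norm_add_le_max _ _).trans (max_le hest h)

end Summit.BirchSwinnertonDyer.BirchSwinnertonDyer.Theorems.EtaPlusCoeffCongruence

end
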